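import Literature.Topology.CoveringSpaces.CoveringMapFibreFunctor
import Mathlib.CategoryTheory.Action.Concrete
import Mathlib.CategoryTheory.Comma.Over.Basic
import Mathlib.Topology.Category.TopCat.Basic
import HarnessLib

/-!
# The Galois correspondence for covering spaces, categorical form: the fibre functor
# `Cov(X) ⥤ π₁(X, x₀)-Set` is fully faithful (Hatcher, Thm. 1.38; Grothendieck's formulation)

Topic `Literature/Topology/CoveringSpaces` — step (D) of the topological Galois correspondence
(abc-iut cell, campaign-L R1, GAP row G-L4t14-R1; classical), packaging the unbundled theorems
of `CoveringMapFibreFunctor.lean` (step (A)):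

* `Cov X` — the category of covering spaces of `X`: the full subcategory of Mathlib's
  `Over (TopCat.of X)` on the objects whose structure map is a covering map (`IsCoveringMap`);
  `Cov.mk p hp`, `Cov.homMk`, `Cov.proj`, `Cov.hom_over`;
* `Cov.fibreFunctor x₀ : Cov X ⥤ Action (Type u) (FundamentalGroup X x₀)` — the fibre over `x₀`
  with its monodromy action (Mathlib `IsCoveringMap.fundamentalGroupMulAction`, `Action.ofMulAction`);
  on morphisms the fibre map of (A) (`CoverMorphism.fibreMap`), equivariant by
  `CoverMorphism.monodromy_fibreMap`;
* `Cov.fibreFunctor_faithful`, `Cov.fibreFunctor_full`, `Cov.fullyFaithfulFibreFunctor` — **for `X`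
  path connected and locally path connected the fibre functor is FULLY FAITHFUL** (Hatcher
  Props. 1.33–1.34 / Thm. 1.38, from (A)'s `eq_of_fibreMap_eq` and `existsUnique_map_of_equivariant`);
* `Cov.iso_of_fibre_iso` — covers with isomorphic fibre `π₁`-sets are isomorphic.

Essential surjectivity (`IsEquivalence`; every `π₁(X, x₀)`-set is a fibre, for `X` moreover
semilocally simply connected) is step (C) of the programme and is added in a sequel once the
associated-covering construction lands; the finite form `Cov^fin X ≌ Action FintypeCat π₁` is the
restriction of the same functor.  Definitions here: `IsCovering`, `Cov`, `Cov.mk`, `Cov.homMk`,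
`Cov.fibreFunctor`, `Cov.fullyFaithfulFibreFunctor`, `Cov.iso_of_fibre_iso`; no instances are
declared (the category structures are Mathlib's); no named facts.

## References

* A. Hatcher, *Algebraic Topology*, CUP 2002, §1.3 Thm. 1.38 and pp. 68–70 («Representing
  Covering Spaces by Permutations»: covering spaces of `X` ↔ sets with a `π₁(X, x₀)`-action,
  morphisms ↔ equivariant maps). [HatcherAT2002]
* A. Grothendieck, M. Raynaud, SGA 1, Exp. V §4–§5 (the fibre functor of a Galois category).
-/

noncomputable section

open CategoryTheory Function Set

universe u

namespace Literature.Topology.CoveringSpaces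

variable (X : Type u) [TopologicalSpace X]

/-- The property «the structure map is a covering map» on spaces over `X`.
[cite: HatcherAT2002, §1.3 p.56 (covering space)] -/
def IsCovering : ObjectProperty (Over (TopCat.of X)) := fun E ↦ IsCoveringMap (E.hom : E.left → X)

/-- **The category `Cov(X)` of covering spaces of `X`**: objects are covering maps `E → X`
(topological spaces over `X` in Mathlib's `Over (TopCat.of X)` whose structure map is a covering
map), morphisms are continuous maps over `X`. [cite: HatcherAT2002, §1.3 p.67 (isomorphism of
covering spaces; maps `f` with `p₁ = p₂ f`)] -/
abbrev Cov : Type (u + 1) := (IsCovering X).FullSubcategory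

namespace Cov

variable {X}

/-- The projection `p : E → X` of a covering space `E ∈ Cov(X)`. [cite: HatcherAT2002, §1.3 p.56] -/
abbrev proj (E : Cov X) : E.obj.left → X := E.obj.hom

/-- The projection of an object of `Cov(X)` is a covering map. [cite: HatcherAT2002, §1.3 p.56] -/
theorem isCoveringMap_proj (E : Cov X) : IsCoveringMap E.proj := E.property

/-- Constructor: a covering map `p : E → X` as an object of `Cov(X)`. [cite: HatcherAT2002, §1.3 p.56] -/
def mk {E : Type u} [TopologicalSpace E] (p : E → X) (hp : IsCoveringMap p) : Cov X :=
  ⟨Over.mk (Y := TopCat.of E) (TopCat.ofHom ⟨p, hp.continuous⟩), hp⟩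

/-- The projection of `Cov.mk p hp` is `p`. [cite: HatcherAT2002, §1.3 p.56] -/
@[simp] theorem proj_mk {E : Type u} [TopologicalSpace E] (p : E → X) (hp : IsCoveringMap p) :
    (mk p hp).proj = p := rfl

/-- A morphism of `Cov(X)` lies over `X`: `p₂ (f e) = p₁ e`. [cite: HatcherAT2002, §1.3 p.67] -/
theorem hom_over {E F : Cov X} (f : E ⟶ F) (e : E.obj.left) : F.proj (f.hom.left e) = E.proj e := by
  have h := Over.w f.hom
  exact congrArg (fun k : E.obj.left ⟶ TopCat.of X ↦ (k : E.obj.left → X) e) h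

/-- A morphism of `Cov(X)` is continuous. [cite: HatcherAT2002, §1.3 p.67] -/
theorem continuous_hom {E F : Cov X} (f : E ⟶ F) : Continuous (f.hom.left : E.obj.left → F.obj.left) :=
  f.hom.left.hom.continuous

/-- Constructor for morphisms of `Cov(X)`: a continuous map over `X`.
[cite: HatcherAT2002, §1.3 p.67] -/
def homMk {E F : Cov X} (g : E.obj.left → F.obj.left) (hg : Continuous g)
    (h : ∀ e, F.proj (g e) = E.proj e) : E ⟶ F :=
  ObjectProperty.homMk (Over.homMk (TopCat.ofHom ⟨g, hg⟩) (by ext e; exact h e))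

/-- The underlying map of `homMk g _ _` is `g`. [cite: HatcherAT2002, §1.3 p.67] -/
@[simp] theorem homMk_apply {E F : Cov X} (g : E.obj.left → F.obj.left) (hg : Continuous g)
    (h : ∀ e, F.proj (g e) = E.proj e) (e : E.obj.left) : (homMk g hg h).hom.left e = g e := rfl

/-- Two morphisms of `Cov(X)` with the same underlying map are equal. [cite: HatcherAT2002, §1.3 p.67] -/
theorem hom_ext {E F : Cov X} {f g : E ⟶ F}
    (h : (f.hom.left : E.obj.left → F.obj.left) = g.hom.left) : f = g := by
  apply ObjectProperty.hom_ext
  ext e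
  exact congrFun h e

/-! ### The fibre functor -/

variable (x₀ : X)

/-- **The fibre functor** `Cov(X) ⥤ π₁(X, x₀)-Set`: a covering space goes to its fibre over `x₀`
with the monodromy action of the fundamental group (Mathlib `IsCoveringMap.fundamentalGroupMulAction`),
a morphism of covers to its fibre map, which is equivariant (`CoverMorphism.monodromy_fibreMap`).
[cite: HatcherAT2002, §1.3 pp.68–70 («the action of π₁(X,x₀) on the fiber F = p⁻¹(x₀)»)] -/
def fibreFunctor : Cov X ⥤ Action (Type u) (FundamentalGroup X x₀) where
  obj E :=
    letI := E.property.fundamentalGroupMulAction x₀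
    Action.ofMulAction (FundamentalGroup X x₀) (E.proj ⁻¹' {x₀})
  map {E F} f :=
    { hom := TypeCat.ofHom (CoverMorphism.fibreMap (p₁ := E.proj) (p₂ := F.proj)
        (f.hom.left : E.obj.left → F.obj.left) (hom_over f) x₀)
      comm := fun γ ↦ by
        ext e
        change CoverMorphism.fibreMap _ (hom_over f) x₀ (E.property.monodromy γ e) =
          F.property.monodromy γ (CoverMorphism.fibreMap _ (hom_over f) x₀ e)
        exact (CoverMorphism.monodromy_fibreMap E.property F.property (continuous_hom f)
          (hom_over f) γ e).symm }
  map_id E := by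
    refine Action.Hom.ext ?_
    ext e
    rfl
  map_comp f g := by
    refine Action.Hom.ext ?_
    ext e
    rfl

/-- The carrier of the fibre `π₁`-set of `E` is the fibre `p⁻¹(x₀)`. [cite: HatcherAT2002, §1.3 p.68] -/
@[simp] theorem fibreFunctor_obj_V (E : Cov X) : ((fibreFunctor x₀).obj E).V = (E.proj ⁻¹' {x₀}) := rfl

/-- The action on the fibre is the monodromy. [cite: HatcherAT2002, §1.3 p.69] -/
theorem fibreFunctor_obj_ρ_apply (E : Cov X) (γ : FundamentalGroup X x₀) (e : E.proj ⁻¹' {x₀}) :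
    ((fibreFunctor x₀).obj E).ρ γ e = E.property.monodromy γ e := rfl

/-- On morphisms the fibre functor is the fibre map. [cite: HatcherAT2002, §1.3 p.69] -/
theorem fibreFunctor_map_apply {E F : Cov X} (f : E ⟶ F) (e : E.proj ⁻¹' {x₀}) :
    ((fibreFunctor x₀).map f).hom e =
      CoverMorphism.fibreMap (f.hom.left : E.obj.left → F.obj.left) (hom_over f) x₀ e := rfl

/-! ### Full faithfulness -/

/-- A morphism of fibre `π₁`-sets commutes with the monodromy, pointwise (`Function.Semiconj` form
used by (A)). [cite: HatcherAT2002, §1.3 p.69] -/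
theorem hom_semiconj {E F : Cov X} (φ : (fibreFunctor x₀).obj E ⟶ (fibreFunctor x₀).obj F)
    (γ : Path.Homotopic.Quotient x₀ x₀) :
    Semiconj (fun e ↦ φ.hom e) (E.property.monodromy γ) (F.property.monodromy γ) :=
  fun e ↦ ConcreteCategory.congr_hom (φ.comm γ) e

variable [PathConnectedSpace X]

/-- **The fibre functor is faithful** (Hatcher Prop. 1.34): over a path-connected base a morphism
of covers is determined by its fibre map over `x₀`. [cite: HatcherAT2002, §1.3 Prop. 1.34] -/
theorem fibreFunctor_faithful : (fibreFunctor (X := X) x₀).Faithful := by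
  refine ⟨fun {E F} f g h ↦ hom_ext ?_⟩
  refine CoverMorphism.eq_of_fibreMap_eq (p₁ := E.proj) (p₂ := F.proj) E.property F.property
    (continuous_hom f) (continuous_hom g) (hom_over f) (hom_over g) x₀ ?_
  funext e
  have := congrArg (fun k : (fibreFunctor x₀).obj E ⟶ (fibreFunctor x₀).obj F ↦ k.hom e) h
  exact this

variable [LocallyPathConnectedSpace X]

/-- The morphism of covers with a prescribed equivariant fibre map (Hatcher Prop. 1.33, via (A)'s
`CoverMorphism.liftOfEquivariant`). [cite: HatcherAT2002, §1.3 Prop. 1.33] -/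
def preimageHom {E F : Cov X} (φ : (fibreFunctor x₀).obj E ⟶ (fibreFunctor x₀).obj F) : E ⟶ F :=
  homMk
    (CoverMorphism.liftOfEquivariant (p₁ := E.proj) (p₂ := F.proj) E.property F.property
      (x₀ := x₀) (fun e ↦ φ.hom e))
    (CoverMorphism.continuous_liftOfEquivariant (hom_semiconj x₀ φ))
    (fun e ↦ CoverMorphism.liftOfEquivariant_spec e)

/-- The fibre map of `preimageHom φ` is `φ`. [cite: HatcherAT2002, §1.3 Prop. 1.33] -/
theorem fibreFunctor_map_preimageHom {E F : Cov X}
    (φ : (fibreFunctor x₀).obj E ⟶ (fibreFunctor x₀).obj F) :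
    (fibreFunctor x₀).map (preimageHom x₀ φ) = φ := by
  refine Action.Hom.ext ?_
  ext e
  apply Subtype.ext
  exact CoverMorphism.liftOfEquivariant_apply_fibre (hom_semiconj x₀ φ) e

/-- **The fibre functor is full** (Hatcher Prop. 1.33 / Thm. 1.38): over a path-connected, locally
path-connected base every equivariant map of fibres is the fibre map of a morphism of covers.
[cite: HatcherAT2002, §1.3 Prop. 1.33, Thm. 1.38] -/
theorem fibreFunctor_full : (fibreFunctor (X := X) x₀).Full :=
  ⟨fun φ ↦ ⟨preimageHom x₀ φ, fibreFunctor_map_preimageHom x₀ φ⟩⟩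

/-- **THE FIBRE FUNCTOR `Cov(X) ⥤ π₁(X, x₀)-Set` IS FULLY FAITHFUL** for `X` path connected and
locally path connected (Hatcher Thm. 1.38, morphism form; SGA 1 V §4 for the topological fibre
functor). [cite: HatcherAT2002, §1.3 Thm. 1.38] -/
def fullyFaithfulFibreFunctor : (fibreFunctor (X := X) x₀).FullyFaithful where
  preimage φ := preimageHom x₀ φ
  map_preimage φ := fibreFunctor_map_preimageHom x₀ φ
  preimage_map _ := (fibreFunctor_faithful x₀).map_injective (fibreFunctor_map_preimageHom x₀ _)

/-- **Covering spaces with isomorphic fibre `π₁`-sets are isomorphic over `X`** (Hatcher Thm. 1.38: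
injectivity on isomorphism classes). [cite: HatcherAT2002, §1.3 Thm. 1.38] -/
def iso_of_fibre_iso {E F : Cov X} (φ : (fibreFunctor x₀).obj E ≅ (fibreFunctor x₀).obj F) : E ≅ F :=
  (fullyFaithfulFibreFunctor x₀).preimageIso φ

/-- Conversely isomorphic covers have isomorphic fibre `π₁`-sets (functoriality), so `E ≅ F` iff
their fibres are isomorphic `π₁(X, x₀)`-sets. [cite: HatcherAT2002, §1.3 Thm. 1.38] -/
theorem nonempty_iso_iff {E F : Cov X} :
    Nonempty (E ≅ F) ↔ Nonempty ((fibreFunctor x₀).obj E ≅ (fibreFunctor x₀).obj F) :=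
  ⟨fun ⟨i⟩ ↦ ⟨(fibreFunctor x₀).mapIso i⟩, fun ⟨φ⟩ ↦ ⟨iso_of_fibre_iso x₀ φ⟩⟩

end Cov

end Literature.Topology.CoveringSpaces

end
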